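import Literature.AnabelianGeometry.EtaleTheta.BiKummerThm44SubModelPairs
import Literature.AnabelianGeometry.EtaleTheta.Discharge.Sec3Thm37StandardWeak

/-!
# [EtTh] Theorem 4.4: "`Ψ` preserves base-Frobenius pairs" (sub-DAG row T44-L04) WITHOUT the perf-factorial
# binder — hence at the WEAK monoid vocabulary `treeMonoidVocabWeak` of record; proof-only companion

S. Mochizuki, *The étale theta function …*, Publ. RIMS **45** (2009) [MochizukiEtTh2009], §4, Thm 4.4, proof
PDF p.94 l.−2 – p.95 l.1: "Thus, `Ψ` preserves pre-steps, morphisms of Frobenius type, Frobenius degrees,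
isometries, and base-Frobenius pairs [cf. [FrdI], Theorem 3.4, (ii), (iii); [FrdI], Corollary 5.7, (i), (iv)]";
S. Mochizuki, *The geometry of Frobenioids I*, Kyushu J. Math. **62** (2008) [MochizukiFrdI2008], Cor. 5.7 (i)
pp.107–108, Rmk. 4.11.1 p.94 ("Corollary 4.11, (ii), may be regarded — at least in the case where the divisor
monoids involved are perf-factorial — as a substantial strengthening of Theorem 3.4, (v) [i.e., one replaces the
hypothesis that the base categories be slim by the hypothesis that they be Div-slim]").

abc-iut cell, layer L2, sub-DAG `plan/L2/SUBDAG-EtTh-Thm44.md` row T44-L04 (custodian abc-iut-w5-d179; landed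
closer abc-iut-w5-d179 gen 2, `BiKummerThm44SubModelPairs.lean` p419233).  PROOF-ONLY companion (seat
abc-iut-w6-d037): no definition, no named fact, nothing restated.

THE POINT.  The landed T44-L04 closers (`Thm44Hyp.cor57Hypotheses`, `…arisesFromBaseFrobeniusPair_map_of_inputs`,
`…_treeVocab`, `…preservesBaseFrobeniusPairs_mkOfModelCanonical`) carry the binders
`hpf_i : ∀ A, IsPerfFactorial (S_i.tf.Φ.carrier A)` — [FrdI] Def. 2.4 (i) AS PRINTED at every object — only
because abc-iut-L1's hypothesis bundle `PreFrobenioid.Cor57Hypotheses` has the fields `perfFactorial₁/₂`.  But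
the SLIM route of [FrdI] Cor. 5.7 (i) that T44-L04 actually calls (`PreFrobenioid.cor57i_pairs_of_isSlim` ←
`cor57i_pairs_of` ← `cor57i_pairs_core`, with [FrdI] Thm. 3.4 (iii) over FSM-type bases
`FrdI.thm34iii_ofFunctor_of_isOfFSMType` and Cor. 4.11 (ii) over SLIM bases
`PreFrobenioid.cor411ii_inst_of_isSlim_of_isOfFSMType` = Thm. 3.4 (v)) never reads those two fields: exactly as
Rmk. 4.11.1 says, perf-factoriality is what the DIV-SLIM strengthening Cor. 4.11 (ii) needs, and the bases
`D_i = B^temp(X_i^log)[𝒟_i]` of Thm 4.4 are SLIM (Rmk 3.7.2).  Cell finding F-L2d2-1 (abc-iut-L2-d2,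
`not_isPerfFactorial_multiplicative_pi_nat` p413961) makes this matter: at the tempered coverings with infinitely
many special-fibre components (`Ÿ`, `Z_∞` — the objects of §§4–5) clause (d) of Def. 2.4 (i) fails, the vocabulary
of record is abc-iut-L2-t3's `treeMonoidVocabWeak` ("perf-factorial" := `IsPerfFactorialCof`,
`FrdIVocabularyWeak.lean`), and there the strong binder `hpf_i` is unavailable — the landed T44-L04 is vacuous at
those objects.  This file removes the binder:

* `cor57i_pairs_of_isSlim_of_clauses` — [FrdI] Cor. 5.7 (i) (quasi-base-Frobenius pairs) over slim bases of
  FSM-type from the INDIVIDUAL clauses {`C_i` Frobenioids, `C_i` of standard type, hypothesis (b) `HypB`} — no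
  `Cor57Hypotheses` bundle, no perf-factoriality, Div-slim derived from slim ([FrdI] Def. 4.5 (iv));
* `Thm44Hyp.hypB_of_isFrobenioid` — hypothesis (b) is vacuous at a tempered Frobenioid (not of group-like type,
  [EtTh] Thm 3.7 (i));
* `Thm44Hyp.arisesFromBaseFrobeniusPair_map_of_clauses`, `Thm44Hyp.preservesBaseFrobeniusPairs_of_clauses` —
  T44-L04 over ANY [FrdI] vocabulary `V`, inputs {`C_i` Frobenioid, `D_i` slim and of FSM-type, `C_i` of standard
  type} ONLY (the landed `_of_inputs` minus `hpf₁`, `hpf₂`);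
* at `treeMonoidVocabWeak` (settings over `treeCatVocab`): `Thm44Hyp.isNonDilatingOn_divisorMonoid₁/₂_weak`
  (abc-iut-L2-d2's weak unfolding of "`Φ_i` non-dilating", feeding the `V`-generic [EtTh] Thm 3.7 (ii) first clause
  `TemperedFrobenioid.isOfStandardType_treeCatVocab`), and **`Thm44Hyp.arisesFromBaseFrobeniusPair_map_treeVocabWeak`,
  `Thm44Hyp.preservesBaseFrobeniusPairs_of_reading_treeVocabWeak`,
  `Thm44Hyp.preservesBaseFrobeniusPairs_mkOfModelCanonical_treeVocabWeak` ⇐ {`Remark372 D₀ / D₀'` (Rmk 3.7.2),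
  `hBmon₁ / hBmon₂` ([FrdI] Thm 5.2 preamble "`𝔹` a monoid on `D`")} ONLY** — T44-L04 at the weak vocabulary, where
  no closer existed;
* at `treeMonoidVocab` nothing new is declared: the landed closers keep their (idle) binders, which there ARE the
  Def 3.6 (ii) field (abc-iut-w5-d179 p431376); the binder-free form is `…_of_clauses` fed with
  `Thm44Hyp.isOfStandardType₁/₂` — same statement text as the weak closers below, hence not repeated (gate dedup).
Downstream (T44-L14 `preservesNthRoots_mkOfModelCanonical` p429785, `thm44_mkOfConnectedTemperoid` p431376) the
binder is only PASSED to T44-L04, so the same substitution removes it there (not repeated in this file).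
HONEST FRAMING: refereed pre-IUT material ([EtTh] §4 over [FrdI] §§3–5); no new `Prop` fact, no statement of the
paper restated or strengthened; nothing here bears on [IUTchIII] Cor. 3.12; typed ≠ proved — here PROVED.
-/

namespace Literature.AnabelianGeometry.EtaleTheta

open CategoryTheory Opposite Literature.AlgebraicGeometry.Frobenioids

namespace BiKummerSetting

universe u₀ v₀ u v w u' v'

/-! ### [FrdI] Cor 5.7 (i) over slim bases of FSM-type from the individual clauses (no perf-factoriality) -/

section Cor57Clauses

variable {D₁ : Type u} [Category.{v} D₁] {Φ₁ : D₁ᵒᵖ ⥤ CommMonCat.{w}} {C₁ : Type u'} [Category.{v'} C₁]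
  (F₁ : C₁ ⥤ ElemFrobenioid Φ₁) {D₂ : Type u} [Category.{v} D₂] {Φ₂ : D₂ᵒᵖ ⥤ CommMonCat.{w}}
  {C₂ : Type u'} [Category.{v'} C₂] (F₂ : C₂ ⥤ ElemFrobenioid Φ₂) (Ψ : C₁ ≌ C₂)

/-- **[FrdI] Cor. 5.7 (i), quasi-base-Frobenius pairs, over SLIM bases of FSM-type, from the individual clauses**
of its standing hypotheses — `C_i` Frobenioids, `C_i` of standard type, and hypothesis (b) "in the group-like case
`Ψ` and a quasi-inverse preserve base-isomorphisms" (`HypB`) — WITHOUT "`Φ_i` perf-factorial" (and with Div-slim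
derived from slim, [FrdI] Def. 4.5 (iv)): `Ψ` maps every base-Frobenius pair `(P₁, F₁)` of `C₁` into a
base-Frobenius pair `(P₂, F₂)` of `C₂`, the Frobenius-sections matching up to the automorphism `τ = Ψ^{ℕ≥1}` of
`ℕ_{≥1}` ([FrdI] Thm. 3.4 (iii)).  Same proof as abc-iut-L1's `PreFrobenioid.cor57i_pairs_of_isSlim` /
`cor57i_pairs_of` (Thm. 3.4 (iii) over FSM-type bases, Cor. 4.11 (ii) over slim bases = Thm. 3.4 (v), then
`cor57i_pairs_core`), which reads no other field of `Cor57Hypotheses` (Rmk. 4.11.1: perf-factoriality serves the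
Div-slim strengthening only). [cite: MochizukiFrdI2008, Cor. 5.7 (i) p.108] -/
theorem cor57i_pairs_of_isSlim_of_clauses (hF₁ : PreFrobenioid.IsFrobenioid F₁)
    (hF₂ : PreFrobenioid.IsFrobenioid F₂) (hD₁ : IsOfFSMType D₁) (hD₂ : IsOfFSMType D₂) (hs₁ : IsSlim D₁)
    (hs₂ : IsSlim D₂) (hst₁ : (PreFrobenioidData.ofFunctor Φ₁ F₁).IsOfStandardType)
    (hst₂ : (PreFrobenioidData.ofFunctor Φ₂ F₂).IsOfStandardType)
    (hB : (PreFrobenioidData.ofFunctor Φ₁ F₁).HypB (PreFrobenioidData.ofFunctor Φ₂ F₂) Ψ)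
    (P₁ : Presection C₁) (Fr₁ : ℕ+ →* End P₁.ι) (hPF : PreFrobenioid.IsBaseFrobeniusPair F₁ P₁ Fr₁) :
    ∃ (P₂ : Presection C₂) (Fr₂ : ℕ+ →* End P₂.ι) (τ : ℕ+ ≃* ℕ+) (h : PreFrobenioid.MapsInto Ψ P₁ P₂),
      PreFrobenioid.IsBaseFrobeniusPair F₂ P₂ Fr₂ ∧
        ∀ (n : ℕ+) (A : C₁) (hA : P₁.obj A),
          Ψ.functor.map ((Fr₁ n).app ⟨A, hA⟩) = (Fr₂ (τ n)).app ⟨Ψ.functor.obj A, h.1 A hA⟩ := by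
  obtain ⟨⟨hft, -, -, -, hpb, -, -⟩, ΨN, hN, -⟩ :=
    FrdI.thm34iii_ofFunctor_of_isOfFSMType hF₁ hF₂ hD₁ hD₂ Ψ hst₁ hst₂ hB
  obtain ⟨ΨBase, ⟨hEq, ⟨η⟩, -⟩, -⟩ :=
    PreFrobenioid.cor411ii_inst_of_isSlim_of_isOfFSMType F₁ F₂ Ψ hF₁ hF₂ hD₁ hD₂ hs₁ hs₂
      { divSlim := ⟨PreFrobenioidData.isDivSlim_of_isSlim _ hs₁, PreFrobenioidData.isDivSlim_of_isSlim _ hs₂⟩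
        standard := ⟨hst₁, hst₂⟩
        hypB := hB }
  haveI := hEq
  obtain ⟨P₂, Fr₂, h, hPF₂, hc⟩ := PreFrobenioid.cor57i_pairs_core F₁ F₂ Ψ ΨBase η hpb hft ΨN hN hPF
  exact ⟨P₂, Fr₂, ΨN, h, hPF₂, hc⟩

end Cor57Clauses

/-! ### T44-L04 over ANY [FrdI] vocabulary, without the perf-factorial binder -/

section Generic

variable {K : Type u₀} [Field K] {K' : Type u₀} [Field K'] {D₀ : Type u₀} [Category.{v₀} D₀]
  {V : FrdIMonoidStub.{w}}
  {X₁ : SemiGraphs.TemperedArithmeticGroup.{u₀} K} {X₂ : SemiGraphs.TemperedArithmeticGroup.{u₀} K'}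
  {D₀' : Type u₀} [Category.{v₀} D₀']
  {T₁ : RealifiedDivisorMonoids (D₀ := D₀) V} {T₂ : RealifiedDivisorMonoids (D₀ := D₀') V}
  {D₁ D₂ : Type u} [Category.{v} D₁] [Category.{v} D₂] {VD₁ : FrdICatStub.{u, v, w} D₁}
  {VD₂ : FrdICatStub.{u, v, w} D₂} {S₁ : BiKummerSetting X₁ T₁ D₁ VD₁} {S₂ : BiKummerSetting X₂ T₂ D₂ VD₂}

/-- **Hypothesis (b) of [FrdI] Thm 3.4 / Cor 4.11 / Cor 5.7 (`HypB`: "if `C₁, C₂` are of group-like type, then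
`Ψ` and a quasi-inverse preserve base-isomorphisms") is VACUOUS at `(C₁, C₂, Ψ)`**: a tempered Frobenioid is not of
group-like type ([EtTh] Thm 3.7 (i), abc-iut's `TemperedFrobenioid.thm37_i_treeClauses_of_isFrobenioid`).
[cite: MochizukiEtTh2009, Thm 3.7 (i) p.79] -/
theorem Thm44Hyp.hypB_of_isFrobenioid (h : Thm44Hyp S₁ S₂) (hF₁ : PreFrobenioid.IsFrobenioid S₁.F) :
    (PreFrobenioidData.ofFunctor S₁.tf.divisorMonoid S₁.F).HypB
      (PreFrobenioidData.ofFunctor S₂.tf.divisorMonoid S₂.F) h.Ψ :=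
  fun g₁ _ => absurd (fun A => g₁.obj A : PreFrobenioid.IsOfType (PreFrobenioid.IsGroupLikeObj S₁.F))
    (TemperedFrobenioid.thm37_i_treeClauses_of_isFrobenioid S₁.tf hF₁).2.2

/-- **"`Ψ` preserves base-Frobenius pairs" ([FrdI] Cor 5.7 (i) at `Ψ`) in the reading of Def 4.1 (iv)(e) by
`TemperedFrobenioid.ArisesFromBaseFrobeniusPair`, WITHOUT the perf-factorial binder, over ANY [FrdI] vocabulary `V`**:
if `G ⊆ Aut_{C₁}(A)`, `α'' : A → A`, `α' : A → B` arise from a base-Frobenius pair `(P₁, F₁)` of `C₁`, then `Ψ(G)`,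
`Ψ(α'')`, `Ψ(α')` arise from the base-Frobenius pair `(P₂, F₂)` of `C₂` that Cor 5.7 (i)
(`cor57i_pairs_of_isSlim_of_clauses`) associates to `(P₁, F₁)`.  Inputs: `C_i` Frobenioids, `D_i` slim and of
FSM-type, `C_i` of standard type — print's p.94 l.−5/−4 "`C_i` is of standard … type [Thm 3.7 (i), (ii)] … the
base category `D_i` of `C_i` is slim [cf. Remark 3.7.2]" and nothing else. [cite: MochizukiEtTh2009, Thm 4.4 p.95] -/
theorem Thm44Hyp.arisesFromBaseFrobeniusPair_map_of_clauses (h : Thm44Hyp S₁ S₂)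
    (hF₁ : PreFrobenioid.IsFrobenioid S₁.F) (hF₂ : PreFrobenioid.IsFrobenioid S₂.F)
    (hD₁ : IsOfFSMType D₁) (hD₂ : IsOfFSMType D₂) (hs₁ : IsSlim D₁) (hs₂ : IsSlim D₂)
    (hst₁ : (PreFrobenioidData.ofFunctor S₁.tf.divisorMonoid S₁.F).IsOfStandardType)
    (hst₂ : (PreFrobenioidData.ofFunctor S₂.tf.divisorMonoid S₂.F).IsOfStandardType)
    {A B : S₁.C} {G : Subgroup (Aut A)} {α₂ : A ⟶ A} {α₁ : A ⟶ B}
    (hG : S₁.tf.ArisesFromBaseFrobeniusPair G α₂ α₁) :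
    S₂.tf.ArisesFromBaseFrobeniusPair (G.map (h.Ψ.functor.mapAut A)) (h.Ψ.functor.map α₂)
      (h.Ψ.functor.map α₁) := by
  obtain ⟨P₁, Fr₁, hPF, hGP, hα₁, ⟨hA, n, hα₂⟩⟩ := hG
  obtain ⟨P₂, Fr₂, τ, hinto, hPF₂, hFr⟩ :=
    cor57i_pairs_of_isSlim_of_clauses S₁.F S₂.F h.Ψ hF₁ hF₂ hD₁ hD₂ hs₁ hs₂ hst₁ hst₂
      (h.hypB_of_isFrobenioid hF₁) P₁ Fr₁ hPF
  refine ⟨P₂, Fr₂, hPF₂, ?_, hinto.2 α₁ hα₁, ⟨hinto.1 A hA, τ n, ?_⟩⟩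
  · intro γ hγ
    obtain ⟨γ₁, hγ₁, rfl⟩ := Subgroup.mem_map.1 hγ
    exact hinto.2 γ₁.hom (hGP γ₁ hγ₁)
  · subst hα₂
    exact (hFr n A hA).symm

/-- **T44-L04 for any pair of settings whose Def 4.1 (iv)(e) field is read by
`TemperedFrobenioid.ArisesFromBaseFrobeniusPair`** (as for `mkOfModelCanonical`, `mkOfConnectedTemperoid`), WITHOUT
the perf-factorial binder, over ANY vocabulary: `Ψ` preserves base-Frobenius pairs ⇐ {`C_i` Frobenioid, `D_i` slim and
of FSM-type, `C_i` of standard type}. [cite: MochizukiEtTh2009, Thm 4.4 p.95] -/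
theorem Thm44Hyp.preservesBaseFrobeniusPairs_of_clauses (h : Thm44Hyp S₁ S₂)
    (hS₁ : ∀ {A B : S₁.C} (G : Subgroup (Aut A)) (α₂ : A ⟶ A) (α₁ : A ⟶ B),
      S₁.ArisesFromBaseFrobeniusPair G α₂ α₁ → S₁.tf.ArisesFromBaseFrobeniusPair G α₂ α₁)
    (hS₂ : ∀ {A B : S₂.C} (G : Subgroup (Aut A)) (α₂ : A ⟶ A) (α₁ : A ⟶ B),
      S₂.tf.ArisesFromBaseFrobeniusPair G α₂ α₁ → S₂.ArisesFromBaseFrobeniusPair G α₂ α₁)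
    (hF₁ : PreFrobenioid.IsFrobenioid S₁.F) (hF₂ : PreFrobenioid.IsFrobenioid S₂.F)
    (hD₁ : IsOfFSMType D₁) (hD₂ : IsOfFSMType D₂) (hs₁ : IsSlim D₁) (hs₂ : IsSlim D₂)
    (hst₁ : (PreFrobenioidData.ofFunctor S₁.tf.divisorMonoid S₁.F).IsOfStandardType)
    (hst₂ : (PreFrobenioidData.ofFunctor S₂.tf.divisorMonoid S₂.F).IsOfStandardType) :
    h.PreservesBaseFrobeniusPairs :=
  fun _ _ G α₂ α₁ hG => hS₂ _ _ _
    (h.arisesFromBaseFrobeniusPair_map_of_clauses hF₁ hF₂ hD₁ hD₂ hs₁ hs₂ hst₁ hst₂ (hS₁ G α₂ α₁ hG))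

/-- The landed (perf-factorial-hypothesis) transport `Thm44Hyp.arisesFromBaseFrobeniusPair_map_of_inputs` is the
special case in which `hpf₁`, `hpf₂` are supplied and ignored — shape check, proves nothing new.
[cite: MochizukiEtTh2009, Thm 4.4 p.95] -/
example (h : Thm44Hyp S₁ S₂)
    (hF₁ : PreFrobenioid.IsFrobenioid S₁.F) (hF₂ : PreFrobenioid.IsFrobenioid S₂.F)
    (_hpf₁ : ∀ A : D₁ᵒᵖ, IsPerfFactorial (S₁.tf.Φ.carrier A))
    (_hpf₂ : ∀ A : D₂ᵒᵖ, IsPerfFactorial (S₂.tf.Φ.carrier A))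
    (hD₁ : IsOfFSMType D₁) (hD₂ : IsOfFSMType D₂) (hs₁ : IsSlim D₁) (hs₂ : IsSlim D₂)
    (hst₁ : (PreFrobenioidData.ofFunctor S₁.tf.divisorMonoid S₁.F).IsOfStandardType)
    (hst₂ : (PreFrobenioidData.ofFunctor S₂.tf.divisorMonoid S₂.F).IsOfStandardType)
    {A B : S₁.C} {G : Subgroup (Aut A)} {α₂ : A ⟶ A} {α₁ : A ⟶ B}
    (hG : S₁.tf.ArisesFromBaseFrobeniusPair G α₂ α₁) :
    S₂.tf.ArisesFromBaseFrobeniusPair (G.map (h.Ψ.functor.mapAut A)) (h.Ψ.functor.map α₂)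
      (h.Ψ.functor.map α₁) :=
  h.arisesFromBaseFrobeniusPair_map_of_clauses hF₁ hF₂ hD₁ hD₂ hs₁ hs₂ hst₁ hst₂ hG

end Generic

/-! ### At the WEAK canonical vocabulary `treeMonoidVocabWeak` (F-L2d2-1): inputs `Remark372`, `hBmon` only -/

section TreeVocabWeak

variable {K : Type u₀} [Field K] {K' : Type u₀} [Field K'] {D₀ : Type u₀} [Category.{v₀} D₀]
  {X₁ : SemiGraphs.TemperedArithmeticGroup.{u₀} K} {X₂ : SemiGraphs.TemperedArithmeticGroup.{u₀} K'}
  {D₀' : Type u₀} [Category.{v₀} D₀']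
  {T₁ : RealifiedDivisorMonoids (D₀ := D₀) treeMonoidVocabWeak.{w}}
  {T₂ : RealifiedDivisorMonoids (D₀ := D₀') treeMonoidVocabWeak.{w}}
  {D₁ D₂ : Type u} [Category.{v} D₁] [Category.{v} D₂]
  {IsRational₁ IsStrictlyRational₁ : (D₁ᵒᵖ ⥤ CommMonCat.{w}) → Prop}
  {IsRational₂ IsStrictlyRational₂ : (D₂ᵒᵖ ⥤ CommMonCat.{w}) → Prop}

section Settings

variable {S₁ : BiKummerSetting X₁ T₁ D₁ (treeCatVocab D₁ IsRational₁ IsStrictlyRational₁)}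
  {S₂ : BiKummerSetting X₂ T₂ D₂ (treeCatVocab D₂ IsRational₂ IsStrictlyRational₂)}

/-- At the weak monoid vocabulary, "`Φ₁` non-dilating" (field `Thm44Hyp.isNonDilating₁`; `treeMonoidVocabWeak.IsNonDilating`
is the tree's `IsNonDilating`, abc-iut-L2-d2's `isNonDilatingOn_iff_pull_weak`) is the [FrdI] Def 1.1 (i) property
`IsNonDilatingOn Φ₁`. [cite: MochizukiEtTh2009, Thm 4.4 p.93] -/
theorem Thm44Hyp.isNonDilatingOn_divisorMonoid₁_weak (h : Thm44Hyp S₁ S₂) : IsNonDilatingOn S₁.tf.divisorMonoid :=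
  (S₁.tf.isNonDilatingOn_iff_pull_weak).mpr h.isNonDilating₁

/-- At the weak monoid vocabulary, "`Φ₂` non-dilating" is `IsNonDilatingOn Φ₂`. [cite: MochizukiEtTh2009, Thm 4.4 p.93] -/
theorem Thm44Hyp.isNonDilatingOn_divisorMonoid₂_weak (h : Thm44Hyp S₁ S₂) : IsNonDilatingOn S₂.tf.divisorMonoid :=
  (S₂.tf.isNonDilatingOn_iff_pull_weak).mpr h.isNonDilating₂

/-- **"`Ψ` preserves base-Frobenius pairs" AT THE WEAK VOCABULARY `treeMonoidVocabWeak`** (TemperedFrobenioid-level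
reading of Def 4.1 (iv)(e)), inputs `Remark372 D₀ / D₀'` (Rmk 3.7.2) and `hBmon₁ / hBmon₂` ([FrdI] Thm 5.2 preamble)
ONLY: "`C_i` Frobenioid" is `isFrobenioid_treeCatVocab_of_isMonoidOn`,
"of standard type" is the `V`-generic `isOfStandardType_treeCatVocab` with the weak non-dilating unfolding,
"`D_i` slim / of FSM-type" are `isSlim_base_i` / `isOfFSMType_base_i`; NO perf-factoriality — the vocabulary of the
tempered coverings with infinitely many special-fibre components (`Ÿ`, `Z_∞`; F-L2d2-1), where the strong binder of
the landed `…_treeVocab` is unavailable. [cite: MochizukiEtTh2009, Thm 4.4 p.95] -/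
theorem Thm44Hyp.arisesFromBaseFrobeniusPair_map_treeVocabWeak (h : Thm44Hyp S₁ S₂)
    (h372 : TemperedFrobenioid.Remark372 D₀) (h372' : TemperedFrobenioid.Remark372 D₀')
    (hBmon₁ : IsMonoidOn S₁.tf.ratFnFunctor) (hBmon₂ : IsMonoidOn S₂.tf.ratFnFunctor)
    {A B : S₁.C} {G : Subgroup (Aut A)} {α₂ : A ⟶ A} {α₁ : A ⟶ B}
    (hG : S₁.tf.ArisesFromBaseFrobeniusPair G α₂ α₁) :
    S₂.tf.ArisesFromBaseFrobeniusPair (G.map (h.Ψ.functor.mapAut A)) (h.Ψ.functor.map α₂)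
      (h.Ψ.functor.map α₁) :=
  h.arisesFromBaseFrobeniusPair_map_of_clauses (S₁.tf.isFrobenioid_treeCatVocab_of_isMonoidOn hBmon₁)
    (S₂.tf.isFrobenioid_treeCatVocab_of_isMonoidOn hBmon₂) (h.isOfFSMType_base₁ h372.2.1)
    (h.isOfFSMType_base₂ h372'.2.1) (h.isSlim_base₁ h372.1) (h.isSlim_base₂ h372'.1)
    (S₁.tf.isOfStandardType_treeCatVocab hBmon₁ (h.isOfFSMType_base₁ h372.2.1).isOfFSMFFType
      h.isNonDilatingOn_divisorMonoid₁_weak)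
    (S₂.tf.isOfStandardType_treeCatVocab hBmon₂ (h.isOfFSMType_base₂ h372'.2.1).isOfFSMFFType
      h.isNonDilatingOn_divisorMonoid₂_weak) hG

/-- **T44-L04 at the weak vocabulary for any pair of settings whose Def 4.1 (iv)(e) field is read by
`TemperedFrobenioid.ArisesFromBaseFrobeniusPair`** ⇐ {`Remark372 D₀ / D₀'`, `hBmon₁ / hBmon₂`}.
[cite: MochizukiEtTh2009, Thm 4.4 p.95] -/
theorem Thm44Hyp.preservesBaseFrobeniusPairs_of_reading_treeVocabWeak (h : Thm44Hyp S₁ S₂)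
    (hS₁ : ∀ {A B : S₁.C} (G : Subgroup (Aut A)) (α₂ : A ⟶ A) (α₁ : A ⟶ B),
      S₁.ArisesFromBaseFrobeniusPair G α₂ α₁ → S₁.tf.ArisesFromBaseFrobeniusPair G α₂ α₁)
    (hS₂ : ∀ {A B : S₂.C} (G : Subgroup (Aut A)) (α₂ : A ⟶ A) (α₁ : A ⟶ B),
      S₂.tf.ArisesFromBaseFrobeniusPair G α₂ α₁ → S₂.ArisesFromBaseFrobeniusPair G α₂ α₁)
    (h372 : TemperedFrobenioid.Remark372 D₀) (h372' : TemperedFrobenioid.Remark372 D₀')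
    (hBmon₁ : IsMonoidOn S₁.tf.ratFnFunctor) (hBmon₂ : IsMonoidOn S₂.tf.ratFnFunctor) :
    h.PreservesBaseFrobeniusPairs :=
  fun _ _ G α₂ α₁ hG => hS₂ _ _ _ (h.arisesFromBaseFrobeniusPair_map_treeVocabWeak h372 h372' hBmon₁ hBmon₂
    (hS₁ G α₂ α₁ hG))

end Settings

/-! ### T44-L04 for the canonical model instances `mkOfModelCanonical` over the weak vocabulary -/

section Model

variable (tf₁ : TemperedFrobenioid T₁ D₁ (treeCatVocab D₁ IsRational₁ IsStrictlyRational₁))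
  (hZ₁ : tf₁.monoidType = MonoidType.Z) (hP₁ : ∀ A : D₁ᵒᵖ, IsPerfect (tf₁.Φ.carrier A))
  (IG₁ : D₁ → Prop) (gS₁ : ∀ A : D₁, IG₁ A → (X₁.Pi →* Aut A))
  (gSs₁ : ∀ (A : D₁) (hA : IG₁ A), Function.Surjective (gS₁ A hA))
  (NH₁ : Subgroup (Field.absoluteGaloisGroup K) → tf₁.category → ℕ+ → Prop) (A₀₁ : tf₁.category)
  (hA₀₁ : PreFrobenioid.IsFrobeniusTrivial tf₁.toElem A₀₁) (hA₀₁' : IG₁ A₀₁.base)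
  (tf₂ : TemperedFrobenioid T₂ D₂ (treeCatVocab D₂ IsRational₂ IsStrictlyRational₂))
  (hZ₂ : tf₂.monoidType = MonoidType.Z) (hP₂ : ∀ A : D₂ᵒᵖ, IsPerfect (tf₂.Φ.carrier A))
  (IG₂ : D₂ → Prop) (gS₂ : ∀ A : D₂, IG₂ A → (X₂.Pi →* Aut A))
  (gSs₂ : ∀ (A : D₂) (hA : IG₂ A), Function.Surjective (gS₂ A hA))
  (NH₂ : Subgroup (Field.absoluteGaloisGroup K') → tf₂.category → ℕ+ → Prop) (A₀₂ : tf₂.category)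
  (hA₀₂ : PreFrobenioid.IsFrobeniusTrivial tf₂.toElem A₀₂) (hA₀₂' : IG₂ A₀₂.base)

/-- **T44-L04 `Thm44Hyp.PreservesBaseFrobeniusPairs` DISCHARGED for the canonical model instances of the §4 setting
OVER THE WEAK VOCABULARY `treeMonoidVocabWeak`** (`mkOfModelCanonical`: Def 4.1 (iv)(e) :=
`TemperedFrobenioid.ArisesFromBaseFrobeniusPair`), from [FrdI] Cor 5.7 (i) over slim FSM-type bases; inputs
`Remark372 D₀ / D₀'` (Rmk 3.7.2) and `hBmon₁ / hBmon₂` ONLY — no perf-factorial binder (unavailable here, F-L2d2-1).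
[cite: MochizukiEtTh2009, Thm 4.4 p.95] -/
theorem Thm44Hyp.preservesBaseFrobeniusPairs_mkOfModelCanonical_treeVocabWeak
    (h : Thm44Hyp (mkOfModelCanonical X₁ tf₁ hZ₁ hP₁ IG₁ gS₁ gSs₁ NH₁ A₀₁ hA₀₁ hA₀₁')
      (mkOfModelCanonical X₂ tf₂ hZ₂ hP₂ IG₂ gS₂ gSs₂ NH₂ A₀₂ hA₀₂ hA₀₂'))
    (h372 : TemperedFrobenioid.Remark372 D₀) (h372' : TemperedFrobenioid.Remark372 D₀')
    (hBmon₁ : IsMonoidOn tf₁.ratFnFunctor) (hBmon₂ : IsMonoidOn tf₂.ratFnFunctor) :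
    h.PreservesBaseFrobeniusPairs :=
  fun _ _ _ _ _ hG => h.arisesFromBaseFrobeniusPair_map_treeVocabWeak h372 h372' hBmon₁ hBmon₂ hG

end Model

end TreeVocabWeak

end BiKummerSetting

end Literature.AnabelianGeometry.EtaleTheta
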